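import Literature.Algebra.Homology.LaurentCech
import Mathlib.Tactic.LinearCombination
import HarnessLib

/-!
# The Čech complex of a free graded module over `A[x₀, …, x_r]`: the cone contraction

Continuation of `Literature/Algebra/Homology/LaurentCech`. For the FREE graded module
`F = F_e = ⊕_{j ∈ J} P(-e_j)` (`K = ⊤ ⊆ P^J`) the localized pieces are explicit:
`v ∈ (F_s)_d` iff every monomial `x^m e_j` of `v` has `|m| = d - e_j` and `m_i ≥ 0` for `i ∉ s`
(`mem_locDeg_top_iff`; Hartshorne III.5, proof of Thm. 5.1: `Γ(U_{i₀…i_p}, 𝒪(n))` is spanned by the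
Laurent monomials of degree `n` with non-negative exponents off `{i₀, …, i_p}`). The Čech complex
`Č_d(F)` therefore splits according to the multidegree `(j, m)`, and on the summand of `m` the complex
is the cochain complex of the faces of the simplex `{0, …, r}` containing `N(m) = {i : m_i < 0}`:
acyclic when `∅ ≠ N(m) ≠ {0, …, r}`, the unreduced simplex (cohomology `A` in degree `0`) when
`N(m) = ∅`, a single top cell when `N(m)` is everything (Stacks Project, Tag 01XT, proof; Hartshorne
III Thm. 5.1, proof). We organise this computation as ONE chain homotopy:

* `LaurentCech.pivot m` — the largest index `i` with `m_i ≥ 0` (if any); `LaurentCech.hom e d q` —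
  **the cone contraction** `h : Č^{q+1}_d(F) → Č^q_d(F)`,
  `(h c)_τ = Σ_{i ∉ τ} ε(τ + i, i) · π_i(c_{τ+i})`, `π_i` keeping the monomials with pivot `i`;
* `LaurentCech.d_hom_add_hom_d` — **the homotopy identity**
  `d ∘ h + h ∘ d = id - [q + 1 = r] · pnone` on `Č^{q+1}_d(F)` for `q ≥ 0`, where `pnone` keeps the
  monomials without pivot (all exponents negative), which only live on the top simplex;
* the coefficient calculus making this a finite computation with signs: `LaurentCech.coef`
  (`γ(g)_{s,j,m}`), `coef_ext`, `coef_d` (coefficients of the ordered Čech differential),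
  `coef_hom_of_pivot` / `coef_hom_eq_zero`, and the sign identity of the cone `sign_cone`
  (from `OrderedCech.sign_mul_sign_erase_add`).

The cohomological consequences (`H^i(Č_d(F)) = 0` for `0 < i < r`, `H^r` finitely generated, zero
above `r`) are drawn in `Literature/Algebra/Homology/LaurentCechFreeCohomology`. Everything is proved;
no hypothesis on `A`. Mathlib searched (pin v4.32): no cohomology of projective space / of graded
modules (`Mathlib/AlgebraicGeometry/ProjectiveSpectrum` has `Proj`, its basic opens and properness only).

## References

* R. Hartshorne, *Algebraic Geometry*, GTM 52, Springer (1977): III Thm. 5.1 and its proof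
  (pp. 225–227). [Hartshorne1977]
* The Stacks Project, Tag 01XT (Cohomology of Schemes, Lemma 30.8.1 and its proof). [StacksProject]
-/

noncomputable section

open Finset AddMonoidAlgebra

universe u

namespace Literature.Algebra.Homology

namespace LaurentCech

variable {A : Type u} [CommRing A] {r : ℕ}

/-! ### Coefficient filters on Laurent polynomials -/

/-- Restricting a Laurent polynomial to the monomials satisfying a predicate `p`, an `A`-linear
endomorphism of `L`. [folklore] -/
def Lfilter (p : Expt r → Prop) [DecidablePred p] : L A r →ₗ[A] L A r where
  toFun x := AddMonoidAlgebra.ofCoeff (x.coeff.filter p)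
  map_add' x y := by ext m; simp [Finsupp.filter_apply]
  map_smul' a x := by ext m; simp [Finsupp.filter_apply]

/-- Coefficients of a filtered Laurent polynomial. [folklore] -/
@[simp] theorem coeff_Lfilter (p : Expt r → Prop) [DecidablePred p] (x : L A r) (m : Expt r) :
    (Lfilter p x).coeff m = if p m then x.coeff m else 0 := by
  simp [Lfilter, Finsupp.filter_apply]

/-- Filtering preserves the degree parts `L_c`. [folklore] -/
theorem Lfilter_mem_Ldeg (p : Expt r → Prop) [DecidablePred p] {c : ℤ} {x : L A r}
    (hx : x ∈ Ldeg A r c) : Lfilter p x ∈ Ldeg A r c := by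
  rw [mem_Ldeg] at hx ⊢
  intro m hm
  rw [coeff_Lfilter] at hm
  split_ifs at hm with h
  · exact hx m hm
  · exact absurd rfl hm

/-! ### The pivot of an exponent vector -/

/-- The *pivot* of an exponent vector `m`: the largest index `i` with `m_i ≥ 0`, if any (`none` iff
all entries of `m` are negative). The cone contraction of the Čech complex of a free module at the
multidegree `m` uses the vertex `pivot m`. [folklore] -/
def pivot (m : Expt r) : WithBot (Fin (r + 1)) :=
  (Finset.univ.filter fun i => 0 ≤ m i).max

/-- If `pivot m = i` then `m_i ≥ 0`. [folklore] -/
theorem nonneg_of_pivot_eq_coe {m : Expt r} {i : Fin (r + 1)} (h : pivot m = i) : 0 ≤ m i := by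
  have := Finset.mem_of_max h
  simpa using this

/-- `pivot m = ⊥` iff all entries of `m` are negative. [folklore] -/
theorem pivot_eq_bot_iff {m : Expt r} : pivot m = ⊥ ↔ ∀ i, m i < 0 := by
  rw [pivot, Finset.max_eq_bot]
  simp [Finset.filter_eq_empty_iff]

/-- If some entry of `m` is non-negative then `m` has a pivot. [folklore] -/
theorem exists_pivot_eq_coe {m : Expt r} (h : ∃ i, 0 ≤ m i) : ∃ i : Fin (r + 1), pivot m = i := by
  induction hp : pivot m using WithBot.recBotCoe with
  | bot =>
    rw [pivot_eq_bot_iff] at hp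
    obtain ⟨i, hi⟩ := h
    exact absurd hi (hp i).not_ge
  | coe i => exact ⟨i, rfl⟩

/-! ### The localized pieces of the free module `P^n` -/

variable {J : Type} (e : J → ℤ)

/-- The set of exponent vectors of total degree `c` which are non-negative outside `s`: the
monomials spanning `(P_{X_s})_c` inside `L`. [folklore] -/
def admissible (s : Finset (Fin (r + 1))) (c : ℤ) : Set (Expt r) :=
  {m | edeg r m = c ∧ ∀ i, i ∉ s → 0 ≤ m i}

/-- Membership in `admissible s c`. [folklore] -/
theorem mem_admissible {s : Finset (Fin (r + 1))} {c : ℤ} {m : Expt r} :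
    m ∈ admissible s c ↔ edeg r m = c ∧ ∀ i, i ∉ s → 0 ≤ m i := Iff.rfl

/-- A Laurent polynomial all of whose exponents are non-negative is a polynomial. [folklore] -/
theorem mem_range_toL_of_coeff {x : L A r} (hx : ∀ m, x.coeff m ≠ 0 → ∀ i, 0 ≤ m i) :
    x ∈ Set.range (toL A r) := by
  classical
  -- `x = Σ_{m ∈ supp x} single m (x_m)` and each term is a `toL (monomial)`
  have key : ∀ (t : Finset (Expt r)), (∀ m ∈ t, ∀ i, 0 ≤ m i) →
      (∑ m ∈ t, AddMonoidAlgebra.single m (x.coeff m)) ∈ Set.range (toL A r) := by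
    intro t ht
    induction t using Finset.induction_on with
    | empty => exact ⟨0, by simp⟩
    | insert m t hm ih =>
      obtain ⟨q, hq⟩ := ih fun m' hm' => ht m' (Finset.mem_insert_of_mem hm')
      obtain ⟨m₀, hm₀⟩ := (mem_range_castExp_iff r m).mpr (ht m (Finset.mem_insert_self m t))
      refine ⟨MvPolynomial.monomial m₀ (x.coeff m) + q, ?_⟩
      rw [Finset.sum_insert hm, map_add, hq, toL_monomial, hm₀]
  have hx' : x = ∑ m ∈ x.coeff.support, AddMonoidAlgebra.single m (x.coeff m) := by
    refine AddMonoidAlgebra.ext (Finsupp.ext fun m' => ?_)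
    rw [AddMonoidAlgebra.coeff_sum]
    simp only [AddMonoidAlgebra.coeff_single]
    rw [Finset.sum_apply']
    simp only [Finsupp.single_apply]
    rw [Finset.sum_ite_eq']
    split_ifs with h
    · rfl
    · simpa using h
  rw [hx']
  exact key _ fun m hm => hx m (by simpa using hm)

/-- **The localized pieces of the free module**: `v ∈ (P^n)_s` iff every monomial occurring in a
coordinate of `v` is non-negative outside `s` (`(P^n)_{X_s} = ⊕_j A[x][x_s^{-1}]`). [folklore] -/
theorem mem_loc_top_iff [Finite J] {s : Finset (Fin (r + 1))} {v : J → L A r} :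
    v ∈ loc (⊤ : Submodule (P A r) (J → P A r)) s ↔
      ∀ j m, (v j).coeff m ≠ 0 → ∀ i, i ∉ s → 0 ≤ m i := by
  classical
  constructor
  · rintro ⟨N, k, -, hv⟩ j m hm i hi
    have h1 : (xs A s N • v) j = toL A r (k j) := by rw [hv]; rfl
    rw [Pi.smul_apply, smul_eq_mul] at h1
    -- `v j = x_s^{-N} toL (k j)`
    have h2 : v j = xs A s (-N) * toL A r (k j) := by
      rw [← h1, ← mul_assoc, xs_neg_mul_xs, one_mul]
    rw [h2, xs, coeff_single_mul, one_mul] at hm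
    by_contra hlt
    push Not at hlt
    apply hm
    apply coeff_toL_eq_zero
    refine ⟨i, ?_⟩
    simp [sx_apply, hi, hlt]
  · intro h
    -- choose `N` larger than all `-m_i`, `i ∈ s`, over the (finite) supports
    obtain ⟨N, hN⟩ : ∃ N : ℕ, ∀ j m, (v j).coeff m ≠ 0 → ∀ i, -(N : ℤ) ≤ m i := by
      have hfin : (⋃ j, ((v j).coeff.support : Set (Expt r))).Finite :=
        Set.finite_iUnion fun j => Finset.finite_toSet _
      obtain ⟨B, hB⟩ : ∃ B : ℕ, ∀ m ∈ ⋃ j, ((v j).coeff.support : Set (Expt r)), ∀ i,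
          -(B : ℤ) ≤ m i := by
        refine ⟨hfin.toFinset.sup fun m => Finset.univ.sup fun i => (m i).natAbs, ?_⟩
        intro m hm i
        have h1 : (m i).natAbs ≤ Finset.univ.sup fun i => (m i).natAbs :=
          Finset.le_sup (f := fun i => (m i).natAbs) (Finset.mem_univ i)
        have h2 : (Finset.univ.sup fun i => (m i).natAbs) ≤
            hfin.toFinset.sup fun m => Finset.univ.sup fun i => (m i).natAbs :=
          Finset.le_sup (f := fun m : Expt r => Finset.univ.sup fun i => (m i).natAbs)
            (hfin.mem_toFinset.mpr hm)
        have := h1.trans h2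
        omega
      exact ⟨B, fun j m hm i => hB m (Set.mem_iUnion.mpr ⟨j, by simpa using hm⟩) i⟩
    have hcoord : ∀ j, xs A s N * v j ∈ Set.range (toL A r) := by
      intro j
      apply mem_range_toL_of_coeff
      intro m hm i
      rw [xs, coeff_single_mul, one_mul] at hm
      by_cases hi : i ∈ s
      · have := hN j _ hm i
        simp only [Pi.sub_apply, sx_apply, hi, if_true] at this
        omega
      · have := h j _ hm i hi
        simp only [Pi.sub_apply, sx_apply, hi, if_false, sub_zero] at this
        exact this
    choose k hk using hcoord
    refine ⟨N, k, Submodule.mem_top, ?_⟩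
    ext j : 1
    rw [Pi.smul_apply, smul_eq_mul, ιK_apply, hk]

/-- **The degree-`d` localized pieces of the free graded module `F_e = ⊕_j P(-e_j)`**:
`(F_s)_d = Π_j span{x^m : |m| = d - e_j, m ≥ 0 off s}`. [folklore] -/
theorem mem_locDeg_top_iff [Finite J] {s : Finset (Fin (r + 1))} {d : ℤ} {v : J → L A r} :
    v ∈ locDeg e (⊤ : Submodule (P A r) (J → P A r)) s d ↔
      ∀ j m, (v j).coeff m ≠ 0 → m ∈ admissible s (d - e j) := by
  rw [mem_locDeg, mem_loc_top_iff, mem_Kdeg]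
  simp only [mem_Ldeg, mem_admissible]
  exact ⟨fun ⟨h1, h2⟩ j m hm => ⟨h2 j m hm, h1 j m hm⟩,
    fun h => ⟨fun j m hm => (h j m hm).2, fun j m hm => (h j m hm).1⟩⟩

open OrderedCech

/-! ### Coefficients of cochains -/

section Coef

variable {F : Finset (Fin (r + 1)) → Submodule A (J → L A r)}

/-- The coefficient `γ(g)_{s,j,m} ∈ A` of the monomial `x^m` in the `j`-th coordinate of the value of
the cochain `g` on `s` (extended by zero to non-simplices). [folklore] -/
def coef {q : ℤ} (g : Cochain F q) (s : Finset (Fin (r + 1))) (j : J) (m : Expt r) : A :=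
  ((g.ext0 s) j).coeff m

/-- Unfolding of `coef`. [folklore] -/
theorem coef_def {q : ℤ} (g : Cochain F q) (s : Finset (Fin (r + 1))) (j : J) (m : Expt r) :
    coef g s j m = ((g.ext0 s) j).coeff m := rfl

/-- On a simplex, `coef` reads the value of the cochain. [folklore] -/
theorem coef_val {q : ℤ} (g : Cochain F q) (σ : Simplex (Fin (r + 1)) q) (j : J) (m : Expt r) :
    coef g σ.1 j m = ((g σ : J → L A r) j).coeff m := by
  rw [coef_def, Cochain.ext0_val]

/-- On a non-simplex, `coef` vanishes. [folklore] -/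
theorem coef_of_not {q : ℤ} (g : Cochain F q) {s : Finset (Fin (r + 1))}
    (hs : ¬ (s.Nonempty ∧ (s.card : ℤ) = q + 1)) (j : J) (m : Expt r) : coef g s j m = 0 := by
  rw [coef_def, Cochain.ext0, dif_neg hs]
  rfl

/-- Two cochains with the same coefficients are equal. [folklore] -/
theorem coef_ext {q : ℤ} {g g' : Cochain F q}
    (h : ∀ (σ : Simplex (Fin (r + 1)) q) j m, coef g σ.1 j m = coef g' σ.1 j m) : g = g' := by
  funext σ
  apply Subtype.ext
  funext j
  refine AddMonoidAlgebra.ext (Finsupp.ext fun m => ?_)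
  have := h σ j m
  rwa [coef_val, coef_val] at this

/-- `coef` is additive. [folklore] -/
theorem coef_add {q : ℤ} (g g' : Cochain F q) (s : Finset (Fin (r + 1))) (j : J) (m : Expt r) :
    coef (g + g') s j m = coef g s j m + coef g' s j m := by
  rw [coef_def, Cochain.ext0_add]
  rfl

/-- `coef` of the zero cochain. [folklore] -/
@[simp] theorem coef_zero {q : ℤ} (s : Finset (Fin (r + 1))) (j : J) (m : Expt r) :
    coef (0 : Cochain F q) s j m = 0 := by
  rw [coef_def, Cochain.ext0]
  split_ifs <;> rfl

/-- `coef` is compatible with negation. [folklore] -/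
theorem coef_neg {q : ℤ} (g : Cochain F q) (s : Finset (Fin (r + 1))) (j : J) (m : Expt r) :
    coef (-g) s j m = -coef g s j m := by
  rw [eq_neg_iff_add_eq_zero, ← coef_add, neg_add_cancel, coef_zero]

/-- `coef` is compatible with subtraction. [folklore] -/
theorem coef_sub {q : ℤ} (g g' : Cochain F q) (s : Finset (Fin (r + 1))) (j : J) (m : Expt r) :
    coef (g - g') s j m = coef g s j m - coef g' s j m := by
  rw [sub_eq_add_neg, coef_add, coef_neg, sub_eq_add_neg]

/-- `coef` of a sum of cochain-values: helper for linear combinations in `L^n`. [folklore] -/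
theorem coeff_sum_smul_apply {ι : Type*} (t : Finset ι) (a : ι → A) (v : ι → J → L A r)
    (j : J) (m : Expt r) :
    ((∑ i ∈ t, a i • v i) j).coeff m = ∑ i ∈ t, a i * ((v i) j).coeff m := by
  rw [Finset.sum_apply, AddMonoidAlgebra.coeff_sum, Finset.sum_apply']
  refine Finset.sum_congr rfl fun i _ => ?_
  rw [Pi.smul_apply, AddMonoidAlgebra.coeff_smul, Finsupp.smul_apply, smul_eq_mul]

variable (hF : Monotone F)

/-- **Coefficients of the Čech differential**: for `#s ≥ 2`,
`γ(d g)_{s} = Σ_{a ∈ s} ε(s, a) γ(g)_{s ∖ a}`. [folklore] -/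
theorem coef_d {q : ℤ} (g : Cochain F q) (s : Finset (Fin (r + 1))) (hs : 2 ≤ s.card) (j : J)
    (m : Expt r) :
    coef (OrderedCech.d F hF q g) s j m = ∑ a ∈ s, sign A s a * coef g (s.erase a) j m := by
  rw [coef_def, ext0_d F hF q g s hs, coeff_sum_smul_apply]
  rfl

end Coef

/-- The value of a cochain extended by zero lies in the member of the family. [folklore] -/
theorem ext0_mem {F : Finset (Fin (r + 1)) → Submodule A (J → L A r)} {q : ℤ} (g : Cochain F q)
    (s : Finset (Fin (r + 1))) : g.ext0 s ∈ F s := by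
  unfold Cochain.ext0
  split_ifs with h
  · exact (g ⟨s, h⟩).2
  · exact (F s).zero_mem

/-- The square of a sign is `1`. [folklore] -/
theorem sign_mul_self (s : Finset (Fin (r + 1))) (a : Fin (r + 1)) : sign A s a * sign A s a = 1 := by
  rw [sign, ← mul_pow, neg_one_mul, neg_neg, one_pow]

/-- **The sign identity of the cone contraction**: for `a ∈ s` and `i ∉ s`,
`ε(s, a) ε((s ∖ a) + i, i) + ε(s + i, i) ε(s + i, a) = 0`. [folklore] -/
theorem sign_cone {s : Finset (Fin (r + 1))} {a i : Fin (r + 1)} (ha : a ∈ s) (hi : i ∉ s) :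
    sign A s a * sign A (insert i (s.erase a)) i + sign A (insert i s) i * sign A (insert i s) a = 0 := by
  have hai : a ≠ i := fun h => hi (h ▸ ha)
  have key := sign_mul_sign_erase_add (A := A) (Finset.mem_insert_of_mem ha) (Finset.mem_insert_self i s)
    hai
  rw [Finset.erase_insert_of_ne (Ne.symm hai), Finset.erase_insert hi] at key
  have hX := sign_mul_self (A := A) (insert i s) a
  have hW := sign_mul_self (A := A) s a
  linear_combination (sign A (insert i s) a * sign A s a) * key -
    (sign A (insert i (s.erase a)) i * sign A s a) * hX - (sign A (insert i s) i * sign A (insert i s) a) * hW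

/-! ### The cone contraction of the Čech complex of a free graded module -/

section Free

variable (d : ℤ)

variable (A r) in
/-- The family `s ↦ (F_s)_d` of degree-`d` localized pieces of the free graded module
`F = F_e = ⊕_j P(-e_j)` (all of `P^n`, with the grading shifted by `e`). [folklore] -/
abbrev freeFam (s : Finset (Fin (r + 1))) : Submodule A (J → L A r) :=
  locDeg e (⊤ : Submodule (P A r) (J → P A r)) s d

/-- The family `s ↦ (F_s)_d` is monotone. [folklore] -/
theorem freeFam_mono : Monotone (freeFam A r e d) := locDeg_mono e ⊤ d

/-- Coordinatewise coefficient filter on `L^n`. [folklore] -/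
def Kfilter (p : Expt r → Prop) [DecidablePred p] : (J → L A r) →ₗ[A] (J → L A r) :=
  (Lfilter p).compLeft J

/-- Coefficients of a filtered vector. [folklore] -/
@[simp] theorem coeff_Kfilter (p : Expt r → Prop) [DecidablePred p] (v : J → L A r) (j : J)
    (m : Expt r) : ((Kfilter p v) j).coeff m = if p m then (v j).coeff m else 0 := by
  simp [Kfilter]

variable {e d} [Finite J]

/-- Filtering preserves the members of the free family. [folklore] -/
theorem Kfilter_mem_freeFam (p : Expt r → Prop) [DecidablePred p] {s : Finset (Fin (r + 1))}
    {v : J → L A r} (hv : v ∈ freeFam A r e d s) : Kfilter p v ∈ freeFam A r e d s := by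
  rw [mem_locDeg_top_iff] at hv ⊢
  intro j m hm
  rw [coeff_Kfilter] at hm
  split_ifs at hm with h
  · exact hv j m hm
  · exact absurd rfl hm

/-- Keeping only the monomials with pivot `i` moves `(F_{s + i})_d` into `(F_s)_d`: such monomials are
non-negative at `i`. [folklore] -/
theorem Kfilter_pivot_mem_freeFam {s : Finset (Fin (r + 1))} (i : Fin (r + 1)) {v : J → L A r}
    (hv : v ∈ freeFam A r e d (insert i s)) :
    Kfilter (fun m => pivot m = i) v ∈ freeFam A r e d s := by
  rw [mem_locDeg_top_iff] at hv ⊢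
  intro j m hm
  rw [coeff_Kfilter] at hm
  split_ifs at hm with h
  · obtain ⟨h1, h2⟩ := hv j m hm
    refine ⟨h1, fun l hl => ?_⟩
    by_cases hli : l = i
    · subst hli; exact nonneg_of_pivot_eq_coe h
    · exact h2 l (by simp [hli, hl])
  · exact absurd rfl hm

/-- A vector in `(F_s)_d` has no monomial without pivot unless `s` is everything. [folklore] -/
theorem coeff_eq_zero_of_pivot_eq_bot {s : Finset (Fin (r + 1))} {v : J → L A r}
    (hv : v ∈ freeFam A r e d s) (hs : s ≠ Finset.univ) (j : J) {m : Expt r} (hm : pivot m = ⊥) :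
    (v j).coeff m = 0 := by
  by_contra hne
  rw [mem_locDeg_top_iff] at hv
  obtain ⟨-, h2⟩ := hv j m hne
  rw [pivot_eq_bot_iff] at hm
  apply hs
  rw [Finset.eq_univ_iff_forall]
  intro l
  by_contra hl
  exact (hm l).not_ge (h2 l hl)

variable (e d)

/-- **The cone contraction** `h : Č^{q+1}_d(F) → Č^q_d(F)` of the Čech complex of the free graded
module: `(h c)_τ = Σ_{i ∉ τ} ε(τ + i, i) · π_i(c_{τ + i})`, where `π_i` keeps the monomials with pivot
`i` (the vertex of the cone used for the multidegree `m` is `pivot m`). [folklore] -/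
def hom (q : ℤ) : Cochain (freeFam A r e d) (q + 1) →ₗ[A] Cochain (freeFam A r e d) q where
  toFun c τ := ⟨∑ i ∈ τ.1ᶜ, sign A (insert i τ.1) i • Kfilter (fun m => pivot m = i) (c.ext0 (insert i τ.1)),
    Submodule.sum_mem _ fun i _ => Submodule.smul_mem _ _
      (Kfilter_pivot_mem_freeFam i (ext0_mem c (insert i τ.1)))⟩
  map_add' c c' := by
    funext τ
    apply Subtype.ext
    change ∑ i ∈ τ.1ᶜ, _ = (∑ i ∈ τ.1ᶜ, _) + ∑ i ∈ τ.1ᶜ, _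
    rw [← Finset.sum_add_distrib]
    refine Finset.sum_congr rfl fun i _ => ?_
    rw [Cochain.ext0_add, map_add, smul_add]
  map_smul' a c := by
    funext τ
    apply Subtype.ext
    change ∑ i ∈ τ.1ᶜ, _ = a • ∑ i ∈ τ.1ᶜ, _
    rw [Finset.smul_sum]
    refine Finset.sum_congr rfl fun i _ => ?_
    rw [Cochain.ext0_smul, map_smul, smul_comm]

/-- The value of the cone contraction on a simplex. [folklore] -/
theorem hom_apply_coe {q : ℤ} (c : Cochain (freeFam A r e d) (q + 1)) (τ : Simplex (Fin (r + 1)) q) :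
    ((hom e d q c) τ : J → L A r) =
      ∑ i ∈ τ.1ᶜ, sign A (insert i τ.1) i • Kfilter (fun m => pivot m = i) (c.ext0 (insert i τ.1)) :=
  rfl

/-- Coefficients of the cone contraction at a monomial whose pivot `i` is not in `τ`. [folklore] -/
theorem coef_hom_of_pivot {q : ℤ} (c : Cochain (freeFam A r e d) (q + 1))
    (τ : Simplex (Fin (r + 1)) q) (j : J) {m : Expt r} {i : Fin (r + 1)} (hp : pivot m = i)
    (hi : i ∉ τ.1) :
    coef (hom e d q c) τ.1 j m = sign A (insert i τ.1) i * coef c (insert i τ.1) j m := by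
  rw [coef_val, hom_apply_coe, coeff_sum_smul_apply, Finset.sum_eq_single i]
  · rw [coeff_Kfilter, if_pos hp]
    rfl
  · intro b _ hb
    rw [coeff_Kfilter, if_neg, mul_zero]
    rw [hp]
    exact fun h => hb (WithBot.coe_injective h).symm
  · intro h
    exact absurd (Finset.mem_compl.mpr hi) h

/-- Coefficients of the cone contraction vanish at monomials whose pivot (if any) lies in `τ`.
[folklore] -/
theorem coef_hom_eq_zero {q : ℤ} (c : Cochain (freeFam A r e d) (q + 1))
    (τ : Simplex (Fin (r + 1)) q) (j : J) {m : Expt r} (h : ∀ i : Fin (r + 1), pivot m = i → i ∈ τ.1) :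
    coef (hom e d q c) τ.1 j m = 0 := by
  rw [coef_val, hom_apply_coe, coeff_sum_smul_apply]
  refine Finset.sum_eq_zero fun i hi => ?_
  rw [coeff_Kfilter, if_neg, mul_zero]
  exact fun hp => Finset.mem_compl.mp hi (h i hp)

/-- The projection of a cochain onto its monomials without pivot (all exponents negative).
[folklore] -/
def pnone (q : ℤ) : Cochain (freeFam A r e d) q →ₗ[A] Cochain (freeFam A r e d) q where
  toFun c σ := ⟨Kfilter (fun m : Expt r => pivot m = ⊥) (c σ : J → L A r), Kfilter_mem_freeFam _ (c σ).2⟩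
  map_add' c c' := by
    funext σ; apply Subtype.ext
    exact map_add (Kfilter (fun m : Expt r => pivot m = ⊥)) (c σ : J → L A r) (c' σ : J → L A r)
  map_smul' a c := by
    funext σ; apply Subtype.ext
    exact map_smul (Kfilter (fun m : Expt r => pivot m = ⊥)) a (c σ : J → L A r)

/-- Coefficients of `pnone c`. [folklore] -/
theorem coef_pnone {q : ℤ} (c : Cochain (freeFam A r e d) q) (σ : Simplex (Fin (r + 1)) q)
    (j : J) (m : Expt r) :
    coef (pnone e d q c) σ.1 j m = if pivot m = ⊥ then coef c σ.1 j m else 0 := by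
  rw [coef_val, coef_val]
  exact coeff_Kfilter (fun m : Expt r => pivot m = ⊥) _ j m

/-- **The homotopy identity** `d ∘ h + h ∘ d = id - [q + 1 = r] · pnone` on `Č^{q+1}_d(F)` for
`q ≥ 0`: the cone contraction with vertex `pivot m` contracts every multidegree `m` having a
pivot, and the multidegrees without pivot only occur on the top simplex. This is the explicit
computation of the Čech cohomology of the twists `𝒪(c)` on `𝐏^r_A` (Stacks Project, Tag 01XT;
Hartshorne III.5.1), organised as a single chain homotopy. [folklore] -/
theorem d_hom_add_hom_d {q : ℤ} (hq : 0 ≤ q) (c : Cochain (freeFam A r e d) (q + 1)) :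
    OrderedCech.d _ (freeFam_mono e d) q (hom e d q c) +
        hom e d (q + 1) (OrderedCech.d _ (freeFam_mono e d) (q + 1) c) =
      c - (if q + 1 = r then pnone e d (q + 1) c else 0) := by
  apply coef_ext
  intro σ j m
  have hσ2 : 2 ≤ σ.1.card := by have := σ.2.2; omega
  rw [coef_add, coef_d _ _ _ hσ2]
  -- the faces `σ ∖ a` are `q`-simplices
  have hface : ∀ a ∈ σ.1, (σ.1.erase a).Nonempty ∧ ((σ.1.erase a).card : ℤ) = q + 1 := by
    intro a ha
    have h1 := Finset.card_erase_of_mem ha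
    have h2 := σ.2.2
    refine ⟨Finset.card_pos.mp (by omega), by omega⟩
  induction hp : pivot m using WithBot.recBotCoe with
  | bot =>
    -- no pivot: everything vanishes, except on the top simplex where `pnone` cancels `c`
    have h1 : ∀ a ∈ σ.1, coef (hom e d q c) (σ.1.erase a) j m = 0 := fun a ha =>
      coef_hom_eq_zero e d c ⟨σ.1.erase a, hface a ha⟩ j fun i hi => by rw [hp] at hi; cases hi
    rw [Finset.sum_eq_zero fun a ha => by rw [h1 a ha, mul_zero], zero_add,
      coef_hom_eq_zero e d _ σ j fun i hi => by rw [hp] at hi; cases hi]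
    split_ifs with hr
    · rw [coef_sub, coef_pnone, if_pos hp, sub_self]
    · rw [sub_zero, coef_val]
      symm
      refine coeff_eq_zero_of_pivot_eq_bot (s := σ.1) (c σ).2 (fun hu => hr ?_) j hp
      have := σ.2.2
      rw [hu, Finset.card_univ, Fintype.card_fin] at this
      omega
  | coe i =>
    -- the right hand side is `γ(c)_σ`
    have hrhs : coef (c - if q + 1 = (r : ℤ) then pnone e d (q + 1) c else 0) σ.1 j m = coef c σ.1 j m := by
      split_ifs with hr
      · rw [coef_sub, coef_pnone, hp, if_neg (by simp), sub_zero]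
      · rw [sub_zero]
    rw [hrhs]
    by_cases hi : i ∈ σ.1
    · -- pivot inside `σ`: only the face `σ ∖ i` contributes
      rw [coef_hom_eq_zero e d _ σ j fun i' hi' => by
          rw [hp] at hi'; rwa [← WithBot.coe_injective hi'], add_zero]
      rw [Finset.sum_eq_single i]
      · rw [coef_hom_of_pivot e d c ⟨σ.1.erase i, hface i hi⟩ j hp (Finset.notMem_erase i σ.1)]
        change sign A σ.1 i * (sign A (insert i (σ.1.erase i)) i * coef c (insert i (σ.1.erase i)) j m) = _
        rw [Finset.insert_erase hi, ← mul_assoc, sign_mul_self, one_mul]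
      · intro a ha hai
        rw [coef_hom_eq_zero e d c ⟨σ.1.erase a, hface a ha⟩ j fun i' hi' => ?_, mul_zero]
        rw [hp] at hi'
        rw [← WithBot.coe_injective hi']
        exact Finset.mem_erase.mpr ⟨Ne.symm hai, hi⟩
      · intro h; exact absurd hi h
    · -- pivot outside `σ`: the cone terms cancel in pairs
      have hins2 : 2 ≤ (insert i σ.1).card := by rw [Finset.card_insert_of_notMem hi]; omega
      rw [coef_hom_of_pivot e d _ σ j hp hi, coef_d _ _ _ hins2, Finset.sum_insert hi,
        Finset.erase_insert hi, mul_add, ← mul_assoc, sign_mul_self, one_mul, Finset.mul_sum]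
      rw [add_comm (coef c σ.1 j m), ← add_assoc, ← Finset.sum_add_distrib]
      convert zero_add (coef c σ.1 j m)
      refine Finset.sum_eq_zero fun a ha => ?_
      have hai : a ≠ i := fun h => hi (h ▸ ha)
      rw [coef_hom_of_pivot e d c ⟨σ.1.erase a, hface a ha⟩ j hp
          (fun h => hi (Finset.mem_of_mem_erase h)),
        Finset.erase_insert_of_ne (Ne.symm hai)]
      change sign A σ.1 a * (sign A (insert i (σ.1.erase a)) i * coef c (insert i (σ.1.erase a)) j m) +
        sign A (insert i σ.1) i * (sign A (insert i σ.1) a * coef c (insert i (σ.1.erase a)) j m) = 0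
      rw [← mul_assoc, ← mul_assoc, ← add_mul, sign_cone ha hi, zero_mul]

end Free

end LaurentCech

end Literature.Algebra.Homology
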